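import Summits.BirchSwinnertonDyer.BirchSwinnertonDyer.Theses.PrintCf2
import Summits.BirchSwinnertonDyer.BirchSwinnertonDyer.Theorems.PrintCf2SplitBadTwoRestrictedControlHolds
import Summits.BirchSwinnertonDyer.BirchSwinnertonDyer.Theorems.PrintCf2RubinValueTwoStrictDefectAtVbarTwoHolds
import HarnessLib

/-!
# STUB-IDEAS k3 (gen 19) — §C, TYPED over the tree: the explicit-witness corollaries H1a/H1b and the
# digit-free composite `NPrimeNaiveAtTwo` («GV char valuation = naive BSD₂ digit»), with the glue
# `nPrimeNaive_of_explicit : H1a → H1b → NPrimeNaiveAtTwo` PROVED (no `sorry`).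

Companion of `STUB_IDEAS_stub_heegnerIndexLowerAtTwo_3_g19.lean` (Mathlib-only digit ledger). HONEST FRAMING:
H1a and H1b are NOT proved here — they are the S3c / S3d theorems of record
(`SelmerLocImage.restrictedControl_two_holds`, `StrictDefectAtVbarTwoHolds.strictDefectAtVbarTwo_holds` /
`StrictDefect.stub_strictDefectAtVbar_two` p698800) with their `∃ eC` / `∃ eδ` OPENED to the witnesses their
proofs construct (R112 executed: `eCtab`, `eδtab` below); landing them is a copy of those proofs with the
first `refine ⟨_, ?_⟩` removed (helper H1, size S, Theses-free). Nothing here proves the stub, the crux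
or BSD; BSD is NOT proved by any of this.
-/

noncomputable section

open scoped Classical

set_option linter.dupNamespace false
set_option autoImplicit false

namespace Summit.BirchSwinnertonDyer.BirchSwinnertonDyer.Cruxes.SplitBadTwoLowerHalfOfFacts.StubIdeasK3G19.Typed

open CategoryTheory Function Field NumberField IsDedekindDomain WeierstrassCurve
open Literature.NumberTheory.EllipticCurves Literature.NumberTheory.EllipticCurves.GreenbergSelmer
open Literature.NumberTheory.EllipticCurves.Agboola2007
open Literature.NumberTheory.EllipticCurves.IwasawaAlgebra
open Literature.NumberTheory.EllipticCurves.IwasawaDual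
open Literature.NumberTheory.EllipticCurves.ResKernel
open Literature.NumberTheory.GaloisRepresentations
open Literature.NumberTheory.GaloisRepresentations.DiscreteGaloisModule (SelmerStructure)
open Literature.NumberTheory.GaloisCohomology

/-- R112 executed: the S3c witness `e_C = e_K + e_v̄ + e_s − e_k − e_Γ` with `e_K = e₁ + e₃`,
`e₁ = −[key = (1,3)]`, `e₃ = 0`, `e_v̄ = LK`, `e_s = −1`, `e_k = e_Γ = 0` (cut 10's lambda, verbatim components). -/
def eCtab : ℤ → ℤ → ℤ := fun a b ↦
  ((if a = 1 ∧ b = 3 then -1 else 0) + 0)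
    + (if (a = 1 ∧ b = 7) ∨ (a = 0 ∧ (b = 1 ∨ b = 3 ∨ b = 5)) then 1 else 0) + (-1) - 0 - 0

/-- The S3d witness `e_δ` of p698800, verbatim. -/
def eδtab : ℤ → ℤ → ℤ := fun k₁ k₂ ↦ if k₁ = 1 ∧ k₂ = 3 then 2 else if k₁ = 0 ∧ k₂ = 7 then 1 else 0

/-- Squarefree ⟹ `4 ∤ d`. -/
theorem not_four_dvd_of_squarefree {d : ℤ} (hsq : Squarefree d) : ¬ (4 : ℤ) ∣ d := by
  rintro ⟨k, hk⟩
  have h2 : IsUnit (2 : ℤ) := hsq 2 ⟨k, by rw [hk]; ring⟩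
  rw [Int.isUnit_iff] at h2
  omega

/-- The six admissible dyadic keys `(1,3),(1,7) ∣ (0,1),(0,3),(0,5),(0,7)`. -/
def Admissible (i j : ℤ) : Prop := (i = 1 ∧ (j = 3 ∨ j = 7)) ∨ (i = 0 ∧ (j = 1 ∨ j = 3 ∨ j = 5 ∨ j = 7))

theorem admissible_key_of_member {d : ℤ} (hsq : Squarefree d) (hd4 : d % 4 ≠ 1) :
    Admissible (d % 2) ((d / (2 - d % 2)) % 8) := by
  have h4 := not_four_dvd_of_squarefree hsq
  unfold Admissible
  rcases Int.emod_two_eq_zero_or_one d with h | h <;> rw [h] <;> norm_num <;> omega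

/-- THE VANISHING on the six keys: `e_C + e_δ = 0`. -/
theorem vanishing_tab {i j : ℤ} (h : Admissible i j) : eCtab i j + eδtab i j = 0 := by
  rcases h with ⟨rfl, rfl | rfl⟩ | ⟨rfl, rfl | rfl | rfl | rfl⟩ <;> decide

/-- THE VANISHING on members: `e_C([d]₂) + e_δ([d]₂) = 0` for every squarefree `d ≢ 1 (4)`. -/
theorem eCtab_add_eδtab_eq_zero {d : ℤ} (hsq : Squarefree d) (hd4 : d % 4 ≠ 1) :
    eCtab (d % 2) ((d / (2 - d % 2)) % 8) + eδtab (d % 2) ((d / (2 - d % 2)) % 8) = 0 :=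
  vanishing_tab (admissible_key_of_member hsq hd4)

/-- **H1a (explicit S3c).** `restrictedControl_two_holds` with its existential opened to `eCtab`. -/
def RestrictedControlTwoExplicit : Prop :=
    ∀ (d : ℤ), d ≠ 0 → Squarefree d → d % 4 ≠ 1 →
    ∀ (W : WeierstrassCurve ℚ) [W.IsElliptic] [W.IsGloballyMinimal] (C : VariableChange ℚ),
      C • W = cm7.quadraticTwist (d : ℚ) → W.analyticRank = 1 →
    ∀ (K : Type) [Field K] [NumberField K], IsImaginaryQuadratic K →
    ∀ (v vbar : HeightOneSpectrum (𝓞 K)),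
      ((2 : ℕ) : 𝓞 K) ∈ v.asIdeal → ((2 : ℕ) : 𝓞 K) ∈ vbar.asIdeal → vbar ≠ v →
    ∀ (π : (W.baseChange K).endRing), (π : AddMonoid.End (W.baseChange K).geomPoints) * π = π - 2 →
    ∀ (r : ℤ_[2]), r * r = r - 2 →
      (∀ τ ∈ GreenbergSelmer.inertia v, ∀ x : ↥((W.baseChange K).endEigenPrimaryTorsion 2 π r), τ • x = x ∨ τ • x = -x) →
    ∀ (κ' : ZpExtension K 2), κ'.IsUnramifiedOutside vbar → ∀ (γ' : absoluteGaloisGroup K), κ'.IsTopGenerator γ' →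
    ∀ (D : Agboola2007.RestrictedDualData κ' ↥((W.baseChange K).endEigenPrimaryTorsion 2 π r) vbar γ') (n : ℕ),
      Module.Finite (IwasawaAlgebra 2) D.X → D.HasCharValuationAt n →
    ∀ (P : W.toAffine.Point) (c₀ : ℕ) (ℓ : ℤ),
      ¬ IsOfFinAddOrder P →
      (∀ R : W.toAffine.Point, ∃ (k : ℤ) (T : W.toAffine.Point), IsOfFinAddOrder T ∧ R = k • P + T) →
      c₀ ≠ 0 → (W.baseChange ℚ_[2]).IsInReductionKernel (c₀ • W.toPadicPoint 2 P) →
      ‖(W.baseChange ℚ_[2]).padicLogPoint (c₀ • W.toPadicPoint 2 P) / (c₀ : ℚ_[2])‖ = (2 : ℝ) ^ (-ℓ) →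
      (n : ℤ) = ((padicValNat 2 (Nat.card (AddCommGroup.primaryComponent W.sha 2)) : ℤ)
            + (padicValNat 2 W.tamagawaProduct : ℤ)
            - 2 * (padicValNat 2 W.torsionOrder : ℤ) + 2 * ℓ) + eCtab (d % 2) ((d / (2 - d % 2)) % 8)

/-- **H1b (explicit S3d).** `StrictDefectAtVbarTwo` (24036, proved p698800/p699247) with `∃ eδ` opened to `eδtab`. -/
def StrictDefectTwoExplicit : Prop :=
  open scoped Classical in open NumberField IsDedekindDomain Field WeierstrassCurve in open Literature.NumberTheory.GaloisRepresentations Literature.NumberTheory.EllipticCurves in open Literature.NumberTheory.EllipticCurves.Rank1Residual in open Literature.NumberTheory.EllipticCurves.DeShalit1987 in open Summit.BirchSwinnertonDyer.BirchSwinnertonDyer.Theses.PrintCf2 in open Summit.BirchSwinnertonDyer.BirchSwinnertonDyer.Theorems in ∀ (d : ℤ), d ≠ 0 → Squarefree d → d % 4 ≠ 1 → ∀ (W : WeierstrassCurve ℚ) [W.IsElliptic] [W.IsGloballyMinimal] (C : VariableChange ℚ), C • W = cm7.quadraticTwist (d : ℚ) → W.analyticRank = 1 → Finite W.sha → ∀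 (K : Type) [Field K] [NumberField K], IsImaginaryQuadratic K → ∀ (v vbar : HeightOneSpectrum (𝓞 K)), ((2 : ℕ) : 𝓞 K) ∈ v.asIdeal → ((2 : ℕ) : 𝓞 K) ∈ vbar.asIdeal → vbar ≠ v → ∀ (π : (W.baseChange K).endRing), (π : AddMonoid.End (W.baseChange K).geomPoints) * π = π - 2 → ∀ (r : ℤ_[2]), r * r = r - 2 → (∀ τ ∈ GreenbergSelmer.inertia v, ∀ x : ↥((W.baseChange K).endEigenPrimaryTorsion 2 π r), τ • x = x ∨ τ • x = -x) → ∀ (κ' : ZpExtension K 2), κ'.IsUnramifiedOutside vbar → ∀ (γ' : absoluteGaloisGroup K), κ'.IsTopGenerator γ' → ∀ (P : W.toAffine.Point) (c₀ : ℕ) (ℓ : ℤ), ¬ IsOfFinAddOrder P → (∀ R : W.toAffine.Point, ∃ (k : ℤ) (T : W.toAffine.Point), IsOfFinAddOrder T ∧ R = k • P + T) → c₀ ≠ 0 → (W.baseChange ℚ_[2]).IsInReductionKernel (c₀ • W.toPadicPoint 2 P) → ‖(W.baseChange ℚ_[2]).padicLogPoint (c₀ • W.toPadicPoint 2 P) /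 (c₀ : ℚ_[2])‖ = (2 : ℝ) ^ (-ℓ) → ∀ (Dnr : GreenbergVatsal2000.DatumDualData κ' γ' ↥((W.baseChange K).endEigenPrimaryTorsion 2 π r) (Castella2018.AcSelmer.bdpData ↥((W.baseChange K).endEigenPrimaryTorsion 2 π r) 2 vbar) ∅) (n' : ℕ) (H' : IwasawaAlgebra 2), Module.Finite (IwasawaAlgebra 2) Dnr.X → Module.IsTorsion (IwasawaAlgebra 2) Dnr.X → Module.charIdeal (IwasawaAlgebra 2) Dnr.X = Ideal.span {H'} → PowerSeries.constantCoeff H' ≠ 0 → (PowerSeries.constantCoeff H').valuation = n' → ∃ (D : Agboola2007.RestrictedDualData κ' ↥((W.baseChange K).endEigenPrimaryTorsion 2 π r) vbar γ') (n : ℕ), Module.Finite (IwasawaAlgebra 2) D.X ∧ D.HasCharValuationAt n ∧ (n' : ℤ) = n + eδtab (d % 2) ((d / (2 - d % 2)) % 8)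

/-- **ALG, digit-free.** For every S3c₂/S3d frame of a class member and every GV dual datum of the
unramified-at-`v̄` line group with `char = (H')`, `H'(0) ≠ 0`, `ord₂ H'(0) = n'`:
`n' = ord₂ #Ш(W)[2^∞] + ord₂ Tam(W) − 2·ord₂ #W(ℚ)_tors + 2ℓ` — NO dyadic correction. -/
def NPrimeNaiveAtTwo : Prop :=
  open scoped Classical in open NumberField IsDedekindDomain Field WeierstrassCurve in open Literature.NumberTheory.GaloisRepresentations Literature.NumberTheory.EllipticCurves in open Literature.NumberTheory.EllipticCurves.Rank1Residual in open Literature.NumberTheory.EllipticCurves.DeShalit1987 in open Summit.BirchSwinnertonDyer.BirchSwinnertonDyer.Theses.PrintCf2 in open Summit.BirchSwinnertonDyer.BirchSwinnertonDyer.Theorems in ∀ (d : ℤ), d ≠ 0 → Squarefree d → d % 4 ≠ 1 → ∀ (W : WeierstrassCurve ℚ) [W.IsElliptic] [W.IsGloballyMinimal] (C : VariableChange ℚ), C • W = cm7.quadraticTwist (d : ℚ) → W.analyticRank = 1 → Finite W.sha → ∀ (K : Type) [Field K] [NumberField K], IsImaginaryQuadratic K → ∀ (v vbar : HeightOneSpectrum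 (𝓞 K)), ((2 : ℕ) : 𝓞 K) ∈ v.asIdeal → ((2 : ℕ) : 𝓞 K) ∈ vbar.asIdeal → vbar ≠ v → ∀ (π : (W.baseChange K).endRing), (π : AddMonoid.End (W.baseChange K).geomPoints) * π = π - 2 → ∀ (r : ℤ_[2]), r * r = r - 2 → (∀ τ ∈ GreenbergSelmer.inertia v, ∀ x : ↥((W.baseChange K).endEigenPrimaryTorsion 2 π r), τ • x = x ∨ τ • x = -x) → ∀ (κ' : ZpExtension K 2), κ'.IsUnramifiedOutside vbar → ∀ (γ' : absoluteGaloisGroup K), κ'.IsTopGenerator γ' → ∀ (P : W.toAffine.Point) (c₀ : ℕ) (ℓ : ℤ), ¬ IsOfFinAddOrder P → (∀ R : W.toAffine.Point, ∃ (k : ℤ) (T : W.toAffine.Point), IsOfFinAddOrder T ∧ R = k • P + T) → c₀ ≠ 0 → (W.baseChange ℚ_[2]).IsInReductionKernel (c₀ • W.toPadicPoint 2 P) → ‖(W.baseChange ℚ_[2]).padicLogPoint (c₀ • W.toPadicPoint 2 P) / (c₀ : ℚ_[2])‖ = (2 : ℝ) ^ (-ℓ) → ∀ (Dnr : GreenbergVatsal2000.DatumDualData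 κ' γ' ↥((W.baseChange K).endEigenPrimaryTorsion 2 π r) (Castella2018.AcSelmer.bdpData ↥((W.baseChange K).endEigenPrimaryTorsion 2 π r) 2 vbar) ∅) (n' : ℕ) (H' : IwasawaAlgebra 2), Module.Finite (IwasawaAlgebra 2) Dnr.X → Module.IsTorsion (IwasawaAlgebra 2) Dnr.X → Module.charIdeal (IwasawaAlgebra 2) Dnr.X = Ideal.span {H'} → PowerSeries.constantCoeff H' ≠ 0 → (PowerSeries.constantCoeff H').valuation = n' → (n' : ℤ) = ((padicValNat 2 (Nat.card (AddCommGroup.primaryComponent W.sha 2)) : ℤ) + (padicValNat 2 W.tamagawaProduct : ℤ) - 2 * (padicValNat 2 W.torsionOrder : ℤ) + 2 * ℓ)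

/-- GLUE (kernel-checked): H1a → H1b → ALG. -/
theorem nPrimeNaive_of_explicit (hC : RestrictedControlTwoExplicit) (hD : StrictDefectTwoExplicit) :
    NPrimeNaiveAtTwo := by
  intro d hd0 hsq hd4 W _ _ C hCW hrk hSha K _ _ hK v vbar hv hvbar hne π hrel r hr hpin κ' hκ' γ' hγ' P c₀ ℓ
    hP hgen hc₀ hker hlog Dnr n' H' hfg htor hchar hH0 hval
  obtain ⟨D, n, hfinD, hvalD, hn'⟩ := hD d hd0 hsq hd4 W C hCW hrk hSha K hK v vbar hv hvbar hne π hrel r hr hpin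
    κ' hκ' γ' hγ' P c₀ ℓ hP hgen hc₀ hker hlog Dnr n' H' hfg htor hchar hH0 hval
  have hn := hC d hd0 hsq hd4 W C hCW hrk K hK v vbar hv hvbar hne π hrel r hr hpin κ' hκ' γ' hγ' D n hfinD hvalD
    P c₀ ℓ hP hgen hc₀ hker hlog
  have hkey := eCtab_add_eδtab_eq_zero hsq hd4
  push_cast at hn hn' ⊢
  linarith

/-! ## §D  The decomposition's research node, typed: S2′-L₀ = the KEY-FREE one-sided value bound (B25 norm form, `≤`)

`stub_rubinValueFormulaLower_two` of the v4 draft (row 52) states the value law as `∃ eA, … ‖val‖ = 2^{−(2(A+g)+eA(key))/2}`.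
With `e_C + e_δ ≡ 0` (§§A–C) the ONLY thing LOWER consumes from the analytic side is the ONE-SIDED, DIGIT-FREE bound
`‖val‖ ≤ 2^{1/2 − (A+g)}` (`A = v₂ q`, `g = v₂Tam − 2v₂#tors + 2ℓ`), i.e. `m ≥ 2(A+g) − 1` ⟺ `e_A(key) ≥ −1` — the same
binders as the v4 stub (v13 frame, `⊆` clause for THIS `G₂`, any ℚ-generator datum), NO `∃ eA`, NO key digit. -/

section S2primeL0

open Literature.NumberTheory.EllipticCurves.Rank1Residual
open Literature.NumberTheory.EllipticCurves.Rank1Residual.Typed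
open Literature.NumberTheory.EllipticCurves.DeShalit1987
open Summit.BirchSwinnertonDyer.BirchSwinnertonDyer.Theses.PrintCf2
open Summit.BirchSwinnertonDyer.BirchSwinnertonDyer.Theorems

/-- **S2′-L₀ (sub-stub D3 of the decomposition; research-M, SHARED with 23721's kernel up to the digit `e_A ≥ −1`).** -/
def RubinValueLowerKeyFreeAtTwo : Prop :=
    GrossZagier1986_thm_I_7_3 → rank_eq_analyticRank_of_analyticRank_le_one →
    ∀ (d : ℤ), d ≠ 0 → Squarefree d → d % 4 ≠ 1 →
    ∀ (W : WeierstrassCurve ℚ) [W.IsElliptic] [W.IsGloballyMinimal] (C : VariableChange ℚ),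
      C • W = cm7.quadraticTwist (d : ℚ) → W.analyticRank = 1 →
    ∀ (K : Type) [Field K] [NumberField K], IsImaginaryQuadratic K →
    ∀ (v vbar : HeightOneSpectrum (𝓞 K)),
      ((2 : ℕ) : 𝓞 K) ∈ v.asIdeal → ((2 : ℕ) : 𝓞 K) ∈ vbar.asIdeal → vbar ≠ v →
    ∀ (ι : PadicAlgCl 2 ≃+* ℂ),
      (∀ (w : InfinitePlace K) (k : 𝓞 K), k ∈ v.asIdeal ↔ ‖ι.symm (w.embedding (k : K))‖ < 1) →
    ∀ (c : K ≃ₐ[ℚ] K), c ≠ 1 →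
    ∀ (ψ : HeckeCharacter K), ψ.HasInfinityType (fun _ ↦ 1) (fun _ ↦ 0) →
      (∀ s : ℂ, 3 / 2 < s.re → heckeLFunction ψ s = W.LSeries s) →
    ∀ (κ₁ κ₂ : ZpExtension K 2) (γ₁ γ₂ : absoluteGaloisGroup K), ZpExtension.IsTopGeneratorPair κ₁ κ₂ γ₁ γ₂ →
      κ₂.IsUnramifiedOutside vbar →
    ∀ (θ : FramedGaloisRep K (padicCoeffIntegers (∅ : Set (PadicAlgCl 2))) 1)
      (θK ρ : HeckeCharacter K) (r : FramedGaloisRep K (PadicAlgCl 2) 1),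
      (∀ σ : absoluteGaloisGroup K, θ σ ^ 2 = 1) → KellerYin2024.IsHeckeCharOf ι θ θK →
      θK * θK = 1 → IsPAdicAvatarOf ι ρ r → FactorsThroughPair κ₁ κ₂ r →
      θK⁻¹ * ρ = (HeckeCharacter.galConj c ψ)⁻¹ →
    ∀ (Sθ : Finset (HeightOneSpectrum (𝓞 K))), v ∉ Sθ → vbar ∉ Sθ →
      (∀ w ∈ Sθ, ¬ θK.IsUnramifiedAt w) →
      (∀ w : HeightOneSpectrum (𝓞 K), w ∉ Sθ → w ≠ v → w ≠ vbar → θK.IsUnramifiedAt w) →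
    ∀ (Ω δ : ℂ) (Ωp : (unrIntegers 2)ˣ) (G₂ : PowerSeries (PowerSeries (PadicComplexInt 2))),
      Ω ≠ 0 → (δ ^ 2 = (NumberField.discr K : ℂ) ∨ δ ^ 2 = -(NumberField.discr K : ℂ)) →
      IsKatzMeasure₂ ι v vbar Sθ κ₁ κ₂ γ₁⁻¹ γ₂⁻¹ θK⁻¹ Ω δ ((Ωp : unrIntegers 2) : ℂ_[2]) G₂ →
      (∀ D₂ : DualData₂ κ₁ κ₂ (KellerYin2024.charModule (∅ : Set (PadicAlgCl 2)) θ) vbar γ₁ γ₂,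
        Module.Finite (IwasawaAlgebra₂ 2) D₂.X ∧ Module.IsTorsion (IwasawaAlgebra₂ 2) D₂.X ∧
        ∀ (J : ℤ_[2] →+* PadicComplexInt 2),
          (∀ x : ℤ_[2], ((J x : PadicComplexInt 2) : ℂ_[2]) = ((x : ℚ_[2]) : ℂ_[2])) →
          (Module.charIdeal (IwasawaAlgebra₂ 2) D₂.X).map
              (PowerSeries.map (PowerSeries.map J)) ≤ Ideal.span {G₂}) →
    ∀ (P : W.toAffine.Point) (c₀ : ℕ) (ℓ : ℤ),
      ¬ IsOfFinAddOrder P →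
      (∀ R : W.toAffine.Point, ∃ (k : ℤ) (T : W.toAffine.Point), IsOfFinAddOrder T ∧ R = k • P + T) →
      c₀ ≠ 0 → (W.baseChange ℚ_[2]).IsInReductionKernel (c₀ • W.toPadicPoint 2 P) →
      ‖(W.baseChange ℚ_[2]).padicLogPoint (c₀ • W.toPadicPoint 2 P) / (c₀ : ℚ_[2])‖ = (2 : ℝ) ^ (-ℓ) →
    ∃ q : ℚ, shaAn W = (q : ℂ) ∧
      ∀ (val : ℂ_[2]),
        IntSeries.HasValueAt₂ G₂ (avatarValueAt r γ₁⁻¹ - 1) (avatarValueAt r γ₂⁻¹ - 1) val →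
        ‖val‖ ≤ (2 : ℝ) ^ ((1 : ℝ) / 2 - ((padicValRat 2 q + (padicValNat 2 W.tamagawaProduct : ℤ)
              - 2 * (padicValNat 2 W.torsionOrder : ℤ) + 2 * ℓ : ℤ) : ℝ))

end S2primeL0

/-! ## §E  The real-valued glue of the decomposition (norm sandwich ⟹ LOWER's integer inequality)

D2 (CONT⁻, GV road, p694174 shape): `2^{−n′} ≤ ‖val‖`; D3 (S2′-L₀): `‖val‖ ≤ 2^{1/2 − (A+g)}`; D1 (ALG₀, §C): `n′ = B + g`
⟹ `A ≤ B` = `MissingLowerBoundAt W 2` read in valuations (`A = v₂ #Ш_an`, `B = v₂ #Ш[2^∞]`). Integrality of `n′, A + g`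
absorbs the half. -/

theorem lower_of_norm_sandwich {A B g n' x : ℤ} {r : ℝ}
    (hcont : (2 : ℝ) ^ (-(n' : ℝ)) ≤ r) (hval : r ≤ (2 : ℝ) ^ ((1 : ℝ) / 2 - (x : ℝ)))
    (halg : n' = B + g) (hx : x = A + g) : A ≤ B := by
  have h := le_trans hcont hval
  have h' : (-(n' : ℝ)) ≤ (1 : ℝ) / 2 - (x : ℝ) :=
    (Real.rpow_le_rpow_left_iff (by norm_num : (1 : ℝ) < 2)).mp h
  have hlt : ((x : ℤ) : ℝ) < ((n' + 1 : ℤ) : ℝ) := by push_cast; linarith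
  have hlt' : x < n' + 1 := Int.cast_lt.mp hlt
  omega

/-- The half-step is the most the sandwich tolerates: `2^{−n′} ≤ 2^{1/2 − x}` forces `x ≤ n′`. -/
theorem norm_sandwich_excludes_next {n' x : ℤ}
    (h : (2 : ℝ) ^ (-(n' : ℝ)) ≤ (2 : ℝ) ^ ((1 : ℝ) / 2 - (x : ℝ))) : x ≤ n' := by
  have h' : (-(n' : ℝ)) ≤ (1 : ℝ) / 2 - (x : ℝ) :=
    (Real.rpow_le_rpow_left_iff (by norm_num : (1 : ℝ) < 2)).mp h
  have hlt : ((x : ℤ) : ℝ) < ((n' + 1 : ℤ) : ℝ) := by push_cast; linarith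
  have hlt' : x < n' + 1 := Int.cast_lt.mp hlt
  omega

end Summit.BirchSwinnertonDyer.BirchSwinnertonDyer.Cruxes.SplitBadTwoLowerHalfOfFacts.StubIdeasK3G19.Typed

end
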